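import Summits.KontsevichZagierPeriods.KontsevichZagierPeriods.Theses.IsogenyCertificates
import Summits.KontsevichZagierPeriods.KontsevichZagierPeriods.Theorems.IsogenyCertificatesRealPeriodSectorCompleteStubContinuousBranchSemialgebraic
import Summits.KontsevichZagierPeriods.KontsevichZagierPeriods.Theorems.IsogenyCertificatesAlgebraicModuliRealPeriodCellPeriodRep
import Literature.NumberTheory.Transcendental.KZCalculus
import Literature.NumberTheory.Transcendental.ManyCurvePeriods
import Literature.NumberTheory.EllipticCurves.RealLatticePeriod
import Literature.NumberTheory.EllipticCurves.RealLatticePeriodProofs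
import Literature.ModelTheory.ExponentialFields.Semialgebraic

/-!
# Crux `AlgebraicModuliRealPeriodCell` (stmt-KontsevichZagierPeriods-18265) — line `real_multiplier_branch`

Strategist line (planner-cstrat s1, 2026-08-17), registered as an ALTERNATIVE to the lead's line `Sketch`
(the ℚ-engine p119755 ported one field up: S/T/V/Ia/Ib/Ic/C, hardest stub T = `stub_algXMapTransfer`,
the port of the x-rational DATUM transfer engine `XMapPeriodTransferCells.*` to (ℚ̄∩ℝ)[X]-data).

**Idea (transfer lens).** The solved sibling crux `RealPeriodSectorComplete` (stmt-5381, sector over ℚ)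
was closed by the line `period_ratio_branch_cov` (`RealPeriodSectorComplete_of` @ a045c879189a): reduce each
generator to its unbounded component `(e, ∞)`, uniformise by the real period lattice `Λ`
(`℘_Λ(Ω₀/2) = e`, value `= c·Ω₀`), and move ONCE along the β-branch `Φ_β = ℘_{Λ'}(β·℘_Λ⁻¹)`,
`β = Ω₀'/Ω₀`, whose graph lies on an algebraic curve with finite vertical fibres (divided isogeny
curve), hence is ℚ-semialgebraic by CAD. Exactly two steps of that proof used ℚ:
(i) Schneider's two-℘ theorem (commensurability of `Λ` and `β⁻¹Λ'` from a common real period) and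
(ii) the descent of the transformation polynomial to ℚ(X). One field up, inside the kernel form,
(i) is NOT needed: the pairs to be joined are related by a REAL lattice multiplier `νΛ ⊆ Λ'`
(`ν ∈ ℝ`), and then `νΩ₀ = kΩ₀'` (`k ∈ ℤ`, `Λ' ∩ ℝ = ℤΩ₀'`), `β = ν/k`, `kΛ ⊆ β⁻¹Λ'` — elementary;
(ii) becomes the descent to (ℚ̄∩ℝ)(X) by `Aut(ℂ/ℚ̄)` and complex conjugation
(`map_mul_eq_mul_map_of_weierstrassP_mul_eval_eq`, `Complex.mem_subfield_of_forall_ringEquiv`,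
`isAlgebraic_of_isogeny`), and a real polynomial with real-algebraic coefficients still cuts out a
ℚ-semialgebraic set. The other four 5381 stubs port by retyping the coefficients
(ℤ/ℚ → real algebraic), and the CAD stub `stub_continuousBranchSemialgebraic` is already fully general
and is USED AS LANDED below. The kernel form is then the ℚ-engine's cell collapse (p95059) stated
ABSTRACTLY in the relatedness predicate `Rel` (so that ONE landing serves this line with
`Rel :=` real lattice multiplier and the lead's line with `Rel :=` real-algebraic datum), fed with the
independence of really-unrelated curves: Huber–Wüstholz splitting (landed
`stub_huberWustholzSplitting_of`, stated over ℚ̄, fact PROVED as `HuberWustholzManyCurvePeriods_holds`)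
+ conjugation-symmetrised multipliers (`conjSymm_multiplier`, `cm_imaginary_multiplier`, PROVED in
`Cruxes/…/SketchIdeator1.lean`) + Masser's `indep_omega`.

Stubs (6): U `stub_algUnboundedNormalForm` · B `stub_realBranch` · Z `stub_realMultiplierCurve` (NEW) ·
M `stub_algBranchMove` · I `stub_realIsogenyIndependence` · C `stub_cellCollapseRel`. The representations
(the lead's stub S) are LANDED (`PeriodRep.stub_algSectorRepsExist`, p142227) and used as a theorem.
Composition `AlgebraicModuliRealPeriodCell_of` PROVED below (pair transfer and period ratio derived
from U/B/Z/M + the landed CAD stub, exactly as in `RealPeriodSectorComplete_of`).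

Disproof used (Cruxes/…/Disproof.lean @485b31d36b97 + landed Negative/LoadBearing.lean):
`algebraicModuliRealPeriodCell_false_without_eval` — `eval c = 0` is consumed exactly once, inside C, where
I kills the class sums; §5 `no_real_mul_I_of_not_hasCM` / WARNING "the right normal form is pairwise not
joined by a REAL isogeny" — this line's `RealRel` IS that notion (stub I separates the two real types of a
non-CM class); `algebraicModuliRealPeriodCell_iff_without_isAlgebraic` — consistent: algebraicity is used
only where it is genuinely needed (Z: descent ⇒ ℚ-semialgebraic curve; U: `c` algebraic).
-/

noncomputable section

open MeasureTheory Set Filter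
open scoped BigOperators
open Literature.ModelTheory.ExponentialFields (IsSemialgebraic)
open Literature.NumberTheory.Transcendental
open Literature.NumberTheory.Transcendental.KZ

namespace Summit.KontsevichZagierPeriods.KontsevichZagierPeriods.Cruxes.AlgebraicModuliRealPeriodCell.RealMultiplierBranch

open Summit.KontsevichZagierPeriods.KontsevichZagierPeriods.Theses.IsogenyCertificates
  (AlgebraicModuliRealPeriodCell)
open Summit.KontsevichZagierPeriods.IsogenyCertificates.RealPeriodSectorCompleteStubs.ContinuousBranchSemialgebraic
  (stub_continuousBranchSemialgebraic)
open Summit.KontsevichZagierPeriods.IsogenyCertificates.AlgRealPeriodCell.PeriodRep (stub_algSectorRepsExist value_eq)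

/-! ## The six stubs (S is landed: `PeriodRep.stub_algSectorRepsExist`) -/

/-- **U — unbounded normal form with its lattice reading** (port of the LANDED 5381 stubs
`stub_unboundedReduction` (395 lines: max root `e`, roots dichotomy, egg ↦ unbounded Möbius move
`x ↦ e₁ + (e₁−e₂)(e₁−e₃)/(x−e₁)` with coefficients in ℚ(eᵢ) ⊂ ℚ̄∩ℝ, `c = a` or `2a`) and
`stub_realPeriodLattice` (190 lines: `℘_Λ(Ω₀/2) = e`, `value = c·Ω₀` from
`IsReal.integral_Ioi_inv_sqrt_cubic`), retyped from `(A, B) ∈ ℤ²`, `a, c ∈ ℚ` to real-algebraic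
`α, β, a, c`; the lattice clause is stated for EVERY real lattice with invariants `(−4α, −4β)` — the
landed proof derives it from `IsReal` and the invariants only). -/
theorem stub_algUnboundedNormalForm : ∀ (α β : ℝ), IsAlgebraic ℚ α → IsAlgebraic ℚ β → 4 * α ^ 3 + 27 * β ^ 2 ≠ 0 → ∀ (a : ℝ), IsAlgebraic ℚ a → 0 < a → ∀ (r : Literature.NumberTheory.Transcendental.KZ.IntegralRep 1), r.domain = {x | 0 < x 0 ^ 3 + α * x 0 + β} → Set.EqOn r.integrand (fun x => a / Real.sqrt (x 0 ^ 3 + α * x 0 + β)) r.domain → ∃ (e c : ℝ) (r₁ : Literature.NumberTheory.Transcendental.KZ.IntegralRep 1), e ^ 3 + α * e + β = 0 ∧ (∀ x : ℝ, e < x → 0 < x ^ 3 + α * x + β) ∧ IsAlgebraic ℚ c ∧ 0 < c ∧ r₁.domain = {x | e < x 0} ∧ Set.EqOn r₁.integrand (fun x => c / Real.sqrt (x 0 ^ 3 + α * x 0 + β)) r₁.domain ∧ Literature.NumberTheory.Transcendental.KZ.Equivalent r r₁ ∧ ∀ L : PeriodPair, L.IsReal → L.g₂ = -4 * (α : ℂ)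 → L.g₃ = -4 * (β : ℂ) → L.weierstrassPRe (L.minRealPeriod / 2) = e ∧ r₁.value = c * L.minRealPeriod := by
  sorry

/-- **B — the real β-branch** (port of the LANDED 5381 `stub_uniformizedBranch`, 203 lines, pure real
calculus on `ψ = ℘_Λ⁻¹` over `(e, ∞)`; retyped from `(A,B) ∈ ℤ²`, `β ∈ ℚ` to real coefficients and a REAL
ratio `b > 0` — the landed proof uses only `0 < b`): `Φ = ℘_{Λ'}(b·℘_Λ⁻¹)` is a strictly increasing
bijection `(e,∞) → (e',∞)` with `Φ' = b√P'(Φ)/√P`. -/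
theorem stub_realBranch : ∀ (α β α' β' : ℝ) (L L' : PeriodPair), L.IsReal → L'.IsReal → L.g₂ = -4 * (α : ℂ) → L.g₃ = -4 * (β : ℂ) → L'.g₂ = -4 * (α' : ℂ) → L'.g₃ = -4 * (β' : ℂ) → ∀ (b : ℝ), 0 < b → L'.minRealPeriod = b * L.minRealPeriod → ∃ Φ : ℝ → ℝ, StrictMonoOn Φ (Set.Ioi (L.weierstrassPRe (L.minRealPeriod / 2))) ∧ Φ '' Set.Ioi (L.weierstrassPRe (L.minRealPeriod / 2)) = Set.Ioi (L'.weierstrassPRe (L'.minRealPeriod / 2)) ∧ (∀ x : ℝ, L.weierstrassPRe (L.minRealPeriod / 2) < x → HasDerivAt Φ (b * Real.sqrt (Φ x ^ 3 + α' * Φ x + β') / Real.sqrt (x ^ 3 + α * x + β)) x) ∧ ∀ x : ℝ, L.weierstrassPRe (L.minRealPeriod / 2) < x → ∃ z : ℝ, 0 < z ∧ z < L.minRealPeriod / 2 ∧ L.weierstrassP (z : ℂ) = (x : ℂ) ∧ L'.weierstrassP ((b : ℂ) * (z : ℂ)) = (Φ x : ℂ) := by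
  sorry

/-- **Z — the real-multiplier curve** (NEW; replaces 5381's `stub_dividedIsogenyCurve` ∘ Schneider): for
real lattices `Λ, Λ'` with algebraic invariants and a REAL multiplier `νΛ ⊆ Λ'`, the period ratio
`b = Ω₀'/Ω₀` is algebraic (`νΩ₀ ∈ Λ' ∩ ℝ = ℤΩ₀'`, `IsReal.exists_eq_int_mul`, so `ν = kb`, and `ν ∈ ℚ̄` by
`isAlgebraic_of_isogeny`) and the graph of the branch `Φ = ℘_{Λ'}(b·℘_Λ⁻¹)` over `(e, ∞)` lies on a
ℚ-semialgebraic plane set with finite vertical fibres: `℘_{Λ'}(νz) = ν⁻²T(℘_Λ z)` with `T = P/Q` the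
transformation of `Λ ⊆ ν⁻¹Λ'` (`exists_polynomial_weierstrassP_mul_eval_eq_of_le`,
`transformation_polynomial_identity`), descended to (ℚ̄∩ℝ)(X) by `Aut(ℂ/ℚ̄)` + `conj`
(`map_mul_eq_mul_map_of_weierstrassP_mul_eval_eq`, `Complex.mem_subfield_of_forall_ringEquiv`; ℚ-model:
`Polynomial.exists_rat_map_of_forall_map_mul_eq`), and `℘_{Λ'}(νz) = M_k(℘_{Λ'}(bz)) = M_k(Φ x)` by the
multiplication-by-`k` formula (`WeierstrassPMultiplication`, division polynomials with coefficients in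
`ℤ[g₂', g₃']`); `Z := {ν²·φ_k(y)·Q(x) = P(x)·ψ_k²(y)}` (real-algebraic coefficients ⇒ ℚ-semialgebraic,
`isSemialgebraic_setOf_aeval_of_isAlgebraic`), fibres finite as in the landed `finite_fibre`
(`P, Q` coprime). FALLBACK (card trace-hull-orientation): factor through the trace hull to force
`k = ±1`, where `Z = {y·Q(x) = P(x)}` is single-valued. -/
theorem stub_realMultiplierCurve : ∀ (L L' : PeriodPair), L.IsReal → L'.IsReal → IsAlgebraic ℚ L.g₂ → IsAlgebraic ℚ L.g₃ → IsAlgebraic ℚ L'.g₂ → IsAlgebraic ℚ L'.g₃ → ∀ (ν : ℝ), ν ≠ 0 → (∀ l ∈ L.lattice, (ν : ℂ) * l ∈ L'.lattice) → ∀ (b : ℝ), L'.minRealPeriod = b * L.minRealPeriod → ∀ (e : ℝ) (Φ : ℝ → ℝ), (∀ x : ℝ, e < x → ∃ z : ℝ, 0 < z ∧ z < L.minRealPeriod / 2 ∧ L.weierstrassP (z : ℂ) = (x : ℂ) ∧ L'.weierstrassP ((b : ℂ) * (z : ℂ)) = (Φ x : ℂ)) → IsAlgebraic ℚ b ∧ ∃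 Z : Set (Fin 2 → ℝ), Literature.ModelTheory.ExponentialFields.IsSemialgebraic ℚ Z ∧ (∀ x : ℝ, e < x → {y : ℝ | (![x, y] : Fin 2 → ℝ) ∈ Z}.Finite) ∧ ∀ x : ℝ, e < x → (![x, Φ x] : Fin 2 → ℝ) ∈ Z := by
  sorry

/-- **M — the branch move** (port of the LANDED 5381 `stub_branchMove`, 134 lines: the rule-(2) witness
`⟨1, r₁, r₁', Φ̃, Φ̃', graph semialgebraic, HasFDerivWithinAt, injOn, image, c/√P = (c'/√P')(Φ)·Φ', rfl⟩`;
retyped from `ℤ/ℚ` to real coefficients — no arithmetic is used: the semialgebraicity of the two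
integrands is carried by `r₁, r₁'` themselves). [cite: KontsevichZagier2001, §1.2 rule (2)] -/
theorem stub_algBranchMove : ∀ (α β α' β' : ℝ) (e e' : ℝ), (∀ x : ℝ, e < x → 0 < x ^ 3 + α * x + β) → (∀ x : ℝ, e' < x → 0 < x ^ 3 + α' * x + β') → ∀ (b c c' : ℝ), 0 < b → c = b * c' → ∀ (Φ : ℝ → ℝ), StrictMonoOn Φ (Set.Ioi e) → Φ '' Set.Ioi e = Set.Ioi e' → (∀ x : ℝ, e < x → HasDerivAt Φ (b * Real.sqrt (Φ x ^ 3 + α' * Φ x + β') / Real.sqrt (x ^ 3 + α * x + β)) x) → Literature.ModelTheory.ExponentialFields.IsSemialgebraic ℚ {p : Fin 2 → ℝ | e < p 0 ∧ p 1 = Φ (p 0)} → ∀ (r₁ r₁' : Literature.NumberTheory.Transcendental.KZ.IntegralRep 1), r₁.domain = {x | e < x 0} → Set.EqOn r₁.integrand (fun x => c / Real.sqrt (x 0 ^ 3 + α * x 0 + β)) r₁.domain → r₁'.domain = {x | e' < x 0} → Set.EqOn r₁'.integrand (fun x => c' / Real.sqrt (x 0 ^ 3 + α' * x 0 + β'))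 r₁'.domain → Literature.NumberTheory.Transcendental.KZ.of r₁ - Literature.NumberTheory.Transcendental.KZ.of r₁' ∈ Literature.NumberTheory.Transcendental.KZ.changeOfVariablesRel := by
  sorry

/-- **I — independence of really-unrelated curves** (HW one field up, without radicals): the full real
periods `Ω = ∫_{P>0} dx/√P` of nonsingular real-algebraic cubics that are pairwise NOT joined by a REAL
lattice multiplier are (ℚ̄∩ℝ)-linearly independent. Proof plan: uniformise (`uniformization_holds`,
`isReal_of_g₂_g₃_real`, `realPeriod_formula_holds`: `Ω = n·Ω₀`, `n ∈ {1,2}`, `Ω₀ ∈ Λ` so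
`Ω₀ = pω₁ + qω₂`); split the relation along ℂ-isogeny classes (landed `stub_huberWustholzSplitting_of`
over the PROVED `HuberWustholzManyCurvePeriods_holds`); inside a class every member is joined to the
representative `Λ₀` by a real multiplier or by `i`·real (`conjSymm_multiplier`, PROVED in
SketchIdeator1.lean), really-related is an equivalence relation (index inversion), and with CM the two
types merge (`cm_imaginary_multiplier`, PROVED) — so a class carries ≤ 2 of the given curves, of
distinct types, and its relation reads `A(pω₁+qω₂) + iB(p'ω₁+q'ω₂) = 0` with `A, B` REAL algebraic,
killed by Masser's `indep_omega` (real part / imaginary part). [cite: HuberWustholz2022, Thm. 15.3 (1)]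
[cite: Masser1975, Ch. II Thm. II] -/
theorem stub_realIsogenyIndependence : ∀ (k : ℕ) (α β q : Fin k → ℝ), (∀ i, IsAlgebraic ℚ (α i) ∧ IsAlgebraic ℚ (β i) ∧ IsAlgebraic ℚ (q i)) → (∀ i, 4 * α i ^ 3 + 27 * β i ^ 2 ≠ 0) → (∀ i j, i ≠ j → ¬ ∃ (L L' : PeriodPair) (ν : ℝ), L.IsReal ∧ L'.IsReal ∧ L.g₂ = -4 * ((α i : ℝ) : ℂ) ∧ L.g₃ = -4 * ((β i : ℝ) : ℂ) ∧ L'.g₂ = -4 * ((α j : ℝ) : ℂ) ∧ L'.g₃ = -4 * ((β j : ℝ) : ℂ) ∧ ν ≠ 0 ∧ ∀ l ∈ L.lattice, (ν : ℂ) * l ∈ L'.lattice) → ∑ i, q i * (∫ x in {x : Fin 1 → ℝ | 0 < x 0 ^ 3 + α i * x 0 + β i}, 1 / Real.sqrt (x 0 ^ 3 + α i * x 0 + β i)) = 0 → ∀ i, q i = 0 := by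
  sorry

/-- **C — cell collapse, abstract in the relatedness predicate** (port of the LANDED ℚ-engine lever
`stub_cellCollapse`, p95059, 270 lines of bookkeeping in `FormalRep ⧸ relations`: additivity
`a ↦ [R(p,a)]` by rule (1b), merging of a related pair along the transfer with the ratio from (V),
induction on the support, independence of an unrelated support; the landed proof never inspects the
relatedness predicate, so it is stated for an arbitrary `Rel` — this line instantiates `Rel :=` real
lattice multiplier, the lead's line `Rel :=` real-algebraic x-rational datum).
[cite: KontsevichZagier2001, §1.2] -/
theorem stub_cellCollapseRel : ∀ (Rel : ℝ → ℝ → ℝ → ℝ → Prop), (∀ (α β a : ℝ), IsAlgebraic ℚ α → IsAlgebraic ℚ β → IsAlgebraic ℚ a → 4 * α ^ 3 + 27 * β ^ 2 ≠ 0 → ∃ r : Literature.NumberTheory.Transcendental.KZ.IntegralRep 1, r.domain = {x | 0 < x 0 ^ 3 + α * x 0 + β} ∧ r.integrand = fun x => a / Real.sqrt (x 0 ^ 3 + α * x 0 + β)) → (∀ (α β α' β' : ℝ), IsAlgebraic ℚ α → IsAlgebraic ℚ β → IsAlgebraic ℚ α' → IsAlgebraic ℚ β' → 4 * α ^ 3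 + 27 * β ^ 2 ≠ 0 → 4 * α' ^ 3 + 27 * β' ^ 2 ≠ 0 → Rel α β α' β' → ∀ (a a' : ℝ), IsAlgebraic ℚ a → IsAlgebraic ℚ a' → 0 < a → 0 < a' → ∀ (r r' : Literature.NumberTheory.Transcendental.KZ.IntegralRep 1), r.domain = {x | 0 < x 0 ^ 3 + α * x 0 + β} → Set.EqOn r.integrand (fun x => a / Real.sqrt (x 0 ^ 3 + α * x 0 + β)) r.domain → r'.domain = {x | 0 < x 0 ^ 3 + α' * x 0 + β'} → Set.EqOn r'.integrand (fun x => a' / Real.sqrt (x 0 ^ 3 + α' * x 0 + β')) r'.domain → r.value = r'.value → Literature.NumberTheory.Transcendental.KZ.of r - Literature.NumberTheory.Transcendental.KZ.of r' ∈ Literature.NumberTheory.Transcendental.KZ.relations) → (∀ (α β α' β' : ℝ), IsAlgebraic ℚ α → IsAlgebraic ℚ β → IsAlgebraic ℚ α' → IsAlgebraic ℚ β' → 4 * α ^ 3 + 27 * β ^ 2 ≠ 0 → 4 * α' ^ 3 + 27 * β' ^ 2 ≠ 0 → Rel α β α' β' → ∃ q : ℝ, IsAlgebraic ℚ q ∧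 0 < q ∧ (∫ x in {x : Fin 1 → ℝ | 0 < x 0 ^ 3 + α * x 0 + β}, 1 / Real.sqrt (x 0 ^ 3 + α * x 0 + β)) = q * (∫ x in {x : Fin 1 → ℝ | 0 < x 0 ^ 3 + α' * x 0 + β'}, 1 / Real.sqrt (x 0 ^ 3 + α' * x 0 + β'))) → (∀ (k : ℕ) (α β q : Fin k → ℝ), (∀ i, IsAlgebraic ℚ (α i) ∧ IsAlgebraic ℚ (β i) ∧ IsAlgebraic ℚ (q i)) → (∀ i, 4 * α i ^ 3 + 27 * β i ^ 2 ≠ 0) → (∀ i j, i ≠ j → ¬ Rel (α i) (β i) (α j) (β j)) → ∑ i, q i * (∫ x in {x : Fin 1 → ℝ | 0 < x 0 ^ 3 + α i * x 0 + β i}, 1 / Real.sqrt (x 0 ^ 3 + α i * x 0 + β i)) = 0 → ∀ i, q i = 0) → ∀ c ∈ AddSubgroup.closure {d : Literature.NumberTheory.Transcendental.KZ.FormalRep | ∃ (α β a : ℝ) (r : Literature.NumberTheory.Transcendental.KZ.IntegralRep 1), IsAlgebraic ℚ α ∧ IsAlgebraic ℚ β ∧ IsAlgebraic ℚ a ∧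 4 * α ^ 3 + 27 * β ^ 2 ≠ 0 ∧ r.domain = {x | 0 < x 0 ^ 3 + α * x 0 + β} ∧ Set.EqOn r.integrand (fun x => a / Real.sqrt (x 0 ^ 3 + α * x 0 + β)) r.domain ∧ d = Literature.NumberTheory.Transcendental.KZ.of r}, Literature.NumberTheory.Transcendental.KZ.eval c = 0 → c ∈ Literature.NumberTheory.Transcendental.KZ.relations := by
  sorry

/-! ## The relatedness predicate of this line and the composition -/

/-- Relatedness of this line: the two real period lattices (normalisation `℘ = x`: invariants
`(−4α, −4β)`) are joined by a REAL lattice multiplier `νΛ ⊆ Λ'`. -/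
def RealRel (α β α' β' : ℝ) : Prop :=
  ∃ (L L' : PeriodPair) (ν : ℝ), L.IsReal ∧ L'.IsReal ∧ L.g₂ = -4 * (α : ℂ) ∧ L.g₃ = -4 * (β : ℂ) ∧
    L'.g₂ = -4 * (α' : ℂ) ∧ L'.g₃ = -4 * (β' : ℂ) ∧ ν ≠ 0 ∧ ∀ l ∈ L.lattice, (ν : ℂ) * l ∈ L'.lattice

/-- `−4t` is algebraic when `t` is. -/
lemma isAlgebraic_neg_four_mul {t : ℝ} (ht : IsAlgebraic ℚ t) : IsAlgebraic ℚ (-4 * (t : ℂ)) := by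
  have h1 : IsAlgebraic ℚ ((t : ℝ) : ℂ) := by
    simpa using ht.algebraMap (A := ℂ)
  have h4 : IsAlgebraic ℚ (4 : ℂ) := by
    simpa using isAlgebraic_algebraMap (R := ℚ) (A := ℂ) 4
  have e : (-4 * (t : ℂ)) = -(4 * (t : ℂ)) := by ring
  rw [e]
  exact (h4.mul h1).neg

/-- **Pair transfer + period ratio along a real multiplier**, derived from U, B, Z, M and the LANDED CAD
stub `stub_continuousBranchSemialgebraic` exactly as in `RealPeriodSectorComplete_of`. -/
theorem transfer_of_realRel
    (hU : ∀ (α β : ℝ), IsAlgebraic ℚ α → IsAlgebraic ℚ β → 4 * α ^ 3 + 27 * β ^ 2 ≠ 0 → ∀ (a : ℝ), IsAlgebraic ℚ a → 0 < a → ∀ (r : Literature.NumberTheory.Transcendental.KZ.IntegralRep 1), r.domain = {x | 0 < x 0 ^ 3 + α * x 0 + β} → Set.EqOn r.integrand (fun x => a / Real.sqrt (x 0 ^ 3 + α * x 0 + β)) r.domain → ∃ (e c : ℝ) (r₁ : Literature.NumberTheory.Transcendental.KZ.IntegralRep 1), e ^ 3 + α * e + β = 0 ∧ (∀ x : ℝ,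 e < x → 0 < x ^ 3 + α * x + β) ∧ IsAlgebraic ℚ c ∧ 0 < c ∧ r₁.domain = {x | e < x 0} ∧ Set.EqOn r₁.integrand (fun x => c / Real.sqrt (x 0 ^ 3 + α * x 0 + β)) r₁.domain ∧ Literature.NumberTheory.Transcendental.KZ.Equivalent r r₁ ∧ ∀ L : PeriodPair, L.IsReal → L.g₂ = -4 * (α : ℂ) → L.g₃ = -4 * (β : ℂ) → L.weierstrassPRe (L.minRealPeriod / 2) = e ∧ r₁.value = c * L.minRealPeriod)
    (hB : ∀ (α β α' β' : ℝ) (L L' : PeriodPair), L.IsReal → L'.IsReal → L.g₂ = -4 * (α : ℂ) → L.g₃ = -4 * (β : ℂ) → L'.g₂ = -4 * (α' : ℂ) → L'.g₃ = -4 * (β' : ℂ) → ∀ (b : ℝ), 0 < b → L'.minRealPeriod = b * L.minRealPeriod → ∃ Φ : ℝ → ℝ, StrictMonoOn Φ (Set.Ioi (L.weierstrassPRe (L.minRealPeriod / 2))) ∧ Φ '' Set.Ioi (L.weierstrassPRe (L.minRealPeriod / 2)) = Set.Ioi (L'.weierstrassPRe (L'.minRealPeriod / 2)) ∧ (∀ x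 : ℝ, L.weierstrassPRe (L.minRealPeriod / 2) < x → HasDerivAt Φ (b * Real.sqrt (Φ x ^ 3 + α' * Φ x + β') / Real.sqrt (x ^ 3 + α * x + β)) x) ∧ ∀ x : ℝ, L.weierstrassPRe (L.minRealPeriod / 2) < x → ∃ z : ℝ, 0 < z ∧ z < L.minRealPeriod / 2 ∧ L.weierstrassP (z : ℂ) = (x : ℂ) ∧ L'.weierstrassP ((b : ℂ) * (z : ℂ)) = (Φ x : ℂ))
    (hZ : ∀ (L L' : PeriodPair), L.IsReal → L'.IsReal → IsAlgebraic ℚ L.g₂ → IsAlgebraic ℚ L.g₃ → IsAlgebraic ℚ L'.g₂ → IsAlgebraic ℚ L'.g₃ → ∀ (ν : ℝ), ν ≠ 0 → (∀ l ∈ L.lattice, (ν : ℂ) * l ∈ L'.lattice) → ∀ (b : ℝ), L'.minRealPeriod = b * L.minRealPeriod → ∀ (e : ℝ) (Φ : ℝ → ℝ), (∀ x : ℝ, e < x → ∃ z : ℝ, 0 < z ∧ z < L.minRealPeriod / 2 ∧ L.weierstrassP (z : ℂ) = (x : ℂ) ∧ L'.weierstrassP ((b : ℂ) * (z : ℂ))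 = (Φ x : ℂ)) → IsAlgebraic ℚ b ∧ ∃ Z : Set (Fin 2 → ℝ), Literature.ModelTheory.ExponentialFields.IsSemialgebraic ℚ Z ∧ (∀ x : ℝ, e < x → {y : ℝ | (![x, y] : Fin 2 → ℝ) ∈ Z}.Finite) ∧ ∀ x : ℝ, e < x → (![x, Φ x] : Fin 2 → ℝ) ∈ Z)
    (hM : ∀ (α β α' β' : ℝ) (e e' : ℝ), (∀ x : ℝ, e < x → 0 < x ^ 3 + α * x + β) → (∀ x : ℝ, e' < x → 0 < x ^ 3 + α' * x + β') → ∀ (b c c' : ℝ), 0 < b → c = b * c' → ∀ (Φ : ℝ → ℝ), StrictMonoOn Φ (Set.Ioi e) → Φ '' Set.Ioi e = Set.Ioi e' → (∀ x : ℝ, e < x → HasDerivAt Φ (b * Real.sqrt (Φ x ^ 3 + α' * Φ x + β') / Real.sqrt (x ^ 3 + α * x + β)) x) → Literature.ModelTheory.ExponentialFields.IsSemialgebraic ℚ {p : Fin 2 → ℝ | e < p 0 ∧ p 1 = Φ (p 0)} → ∀ (r₁ r₁' : Literature.NumberTheory.Transcendental.KZ.IntegralRep 1), r₁.domain = {x |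 e < x 0} → Set.EqOn r₁.integrand (fun x => c / Real.sqrt (x 0 ^ 3 + α * x 0 + β)) r₁.domain → r₁'.domain = {x | e' < x 0} → Set.EqOn r₁'.integrand (fun x => c' / Real.sqrt (x 0 ^ 3 + α' * x 0 + β')) r₁'.domain → Literature.NumberTheory.Transcendental.KZ.of r₁ - Literature.NumberTheory.Transcendental.KZ.of r₁' ∈ Literature.NumberTheory.Transcendental.KZ.changeOfVariablesRel)
    {α β α' β' : ℝ} (hα : IsAlgebraic ℚ α) (hβ : IsAlgebraic ℚ β) (hα' : IsAlgebraic ℚ α')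
    (hβ' : IsAlgebraic ℚ β') (hΔ : 4 * α ^ 3 + 27 * β ^ 2 ≠ 0) (hΔ' : 4 * α' ^ 3 + 27 * β' ^ 2 ≠ 0)
    (hrel : RealRel α β α' β') {a a' : ℝ} (ha : IsAlgebraic ℚ a) (ha' : IsAlgebraic ℚ a')
    (ha0 : 0 < a) (ha0' : 0 < a') (r r' : IntegralRep 1)
    (hd : r.domain = {x | 0 < x 0 ^ 3 + α * x 0 + β})
    (hi : EqOn r.integrand (fun x => a / Real.sqrt (x 0 ^ 3 + α * x 0 + β)) r.domain)
    (hd' : r'.domain = {x | 0 < x 0 ^ 3 + α' * x 0 + β'})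
    (hi' : EqOn r'.integrand (fun x => a' / Real.sqrt (x 0 ^ 3 + α' * x 0 + β')) r'.domain) :
    (∃ q : ℝ, IsAlgebraic ℚ q ∧ 0 < q ∧ r.value / a = q * (r'.value / a')) ∧
      (r.value = r'.value → KZ.of r - KZ.of r' ∈ KZ.relations) := by
  obtain ⟨L, L', ν, hL, hL', h₂, h₃, h₂', h₃', hν, hmul⟩ := hrel
  -- reduce both sides to the unbounded components, read off the lattices
  obtain ⟨e, c, r₁, he, hpos, hc, hc0, hd₁, hi₁, hE, hlat⟩ := hU α β hα hβ hΔ a ha ha0 r hd hi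
  obtain ⟨e', c', r₁', he', hpos', hc', hc0', hd₁', hi₁', hE', hlat'⟩ :=
    hU α' β' hα' hβ' hΔ' a' ha' ha0' r' hd' hi'
  obtain ⟨heL, hval⟩ := hlat L hL h₂ h₃
  obtain ⟨heL', hval'⟩ := hlat' L' hL' h₂' h₃'
  have hΩ : 0 < L.minRealPeriod := hL.minRealPeriod_pos
  have hΩ' : 0 < L'.minRealPeriod := hL'.minRealPeriod_pos
  -- the period ratio `b = Ω₀'/Ω₀`
  set b : ℝ := L'.minRealPeriod / L.minRealPeriod with hb_def
  have hb : 0 < b := div_pos hΩ' hΩ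
  have hper : L'.minRealPeriod = b * L.minRealPeriod := by
    rw [hb_def, div_mul_cancel₀ _ hΩ.ne']
  -- the branch
  obtain ⟨Φ, hmono, himg, hderiv, hbranch⟩ := hB α β α' β' L L' hL hL' h₂ h₃ h₂' h₃' b hb hper
  rw [heL] at hmono himg hderiv hbranch
  rw [heL'] at himg
  have hcont : ContinuousOn Φ (Ioi e) := fun x hx => (hderiv x hx).continuousAt.continuousWithinAt
  -- the real-multiplier curve through the graph, and algebraicity of `b`
  have hg₂ : IsAlgebraic ℚ L.g₂ := by rw [h₂]; exact isAlgebraic_neg_four_mul hα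
  have hg₃ : IsAlgebraic ℚ L.g₃ := by rw [h₃]; exact isAlgebraic_neg_four_mul hβ
  have hg₂' : IsAlgebraic ℚ L'.g₂ := by rw [h₂']; exact isAlgebraic_neg_four_mul hα'
  have hg₃' : IsAlgebraic ℚ L'.g₃ := by rw [h₃']; exact isAlgebraic_neg_four_mul hβ'
  obtain ⟨hbalg, Z, hZsa, hfin, hgraphZ⟩ :=
    hZ L L' hL hL' hg₂ hg₃ hg₂' hg₃' ν hν hmul b hper e Φ hbranch
  -- values
  have hv : r.value = c * L.minRealPeriod := by rw [Equivalent.value_eq_holds hE, hval]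
  have hv' : r'.value = c' * L'.minRealPeriod := by rw [Equivalent.value_eq_holds hE', hval']
  have ha1 : a ≠ 0 := ha0.ne'
  have ha1' : a' ≠ 0 := ha0'.ne'
  have hc1' : c' ≠ 0 := hc0'.ne'
  have hb1 : b ≠ 0 := hb.ne'
  have hΩ1 : L.minRealPeriod ≠ 0 := hΩ.ne'
  refine ⟨?_, fun hvv => ?_⟩
  · -- the ratio `q = c a' / (a c' b)`
    refine ⟨c * a' / (a * (c' * b)), ?_, by positivity, ?_⟩
    · rw [div_eq_mul_inv]
      exact (hc.mul ha').mul ((ha.mul (hc'.mul hbalg)).inv)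
    · rw [hv, hv', hper]
      field_simp
  · -- value equality along the sound reductions gives `c = b c'`
    have hv₁ : r₁.value = r₁'.value := by
      rw [← Equivalent.value_eq_holds hE, ← Equivalent.value_eq_holds hE', hvv]
    have hcc' : c = b * c' := by
      have h1 : c * L.minRealPeriod = c' * L'.minRealPeriod := by rw [← hval, ← hval', hv₁]
      rw [hper] at h1
      have hΩ0 : L.minRealPeriod ≠ 0 := hΩ.ne'
      have : (c - b * c') * L.minRealPeriod = 0 := by linear_combination h1
      rcases mul_eq_zero.mp this with h | h
      · linarith
      · exact absurd h hΩ0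
    -- the graph of the branch is semialgebraic (landed CAD stub)
    have hdomSA : IsSemialgebraic ℚ {p : Fin 1 → ℝ | e < p 0} := by
      have h := r₁.isSemialgebraic_domain
      rwa [hd₁] at h
    have hgraph : IsSemialgebraic ℚ {p : Fin 2 → ℝ | e < p 0 ∧ p 1 = Φ (p 0)} :=
      stub_continuousBranchSemialgebraic e Φ Z hdomSA hZsa (fun x hx => hfin x hx) hcont
        (fun x hx => hgraphZ x hx)
    -- one change of variables between the unbounded components
    have hmove := hM α β α' β' e e' hpos hpos' b c c' hb hcc' Φ hmono himg hderiv hgraph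
      r₁ r₁' hd₁ hi₁ hd₁' hi₁'
    have h₁₁' : KZ.of r₁ - KZ.of r₁' ∈ KZ.relations := changeOfVariablesRel_subset_relations hmove
    have hE1 : KZ.of r - KZ.of r₁ ∈ KZ.relations := hE
    have hE2 : KZ.of r' - KZ.of r₁' ∈ KZ.relations := hE'
    have : KZ.of r - KZ.of r' = (KZ.of r - KZ.of r₁) + (KZ.of r₁ - KZ.of r₁') - (KZ.of r' - KZ.of r₁') := by
      abel
    rw [this]
    exact sub_mem (add_mem hE1 h₁₁') hE2

/-- **The line closes the crux BY NAME**: composition of the six stubs (+ the landed S). -/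
theorem AlgebraicModuliRealPeriodCell_of
    (hU : ∀ (α β : ℝ), IsAlgebraic ℚ α → IsAlgebraic ℚ β → 4 * α ^ 3 + 27 * β ^ 2 ≠ 0 → ∀ (a : ℝ), IsAlgebraic ℚ a → 0 < a → ∀ (r : Literature.NumberTheory.Transcendental.KZ.IntegralRep 1), r.domain = {x | 0 < x 0 ^ 3 + α * x 0 + β} → Set.EqOn r.integrand (fun x => a / Real.sqrt (x 0 ^ 3 + α * x 0 + β)) r.domain → ∃ (e c : ℝ) (r₁ : Literature.NumberTheory.Transcendental.KZ.IntegralRep 1), e ^ 3 + α * e + β = 0 ∧ (∀ x : ℝ, e < x → 0 < x ^ 3 + α * x + β) ∧ IsAlgebraic ℚ c ∧ 0 < c ∧ r₁.domain = {x | e < x 0} ∧ Set.EqOn r₁.integrand (fun x => c / Real.sqrt (x 0 ^ 3 + α * x 0 + β)) r₁.domain ∧ Literature.NumberTheory.Transcendental.KZ.Equivalent r r₁ ∧ ∀ L : PeriodPair, L.IsReal → L.g₂ = -4 * (α : ℂ) → L.g₃ = -4 * (β : ℂ) → L.weierstrassPRe (L.minRealPeriod / 2) = e ∧ r₁.value =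 c * L.minRealPeriod)
    (hB : ∀ (α β α' β' : ℝ) (L L' : PeriodPair), L.IsReal → L'.IsReal → L.g₂ = -4 * (α : ℂ) → L.g₃ = -4 * (β : ℂ) → L'.g₂ = -4 * (α' : ℂ) → L'.g₃ = -4 * (β' : ℂ) → ∀ (b : ℝ), 0 < b → L'.minRealPeriod = b * L.minRealPeriod → ∃ Φ : ℝ → ℝ, StrictMonoOn Φ (Set.Ioi (L.weierstrassPRe (L.minRealPeriod / 2))) ∧ Φ '' Set.Ioi (L.weierstrassPRe (L.minRealPeriod / 2)) = Set.Ioi (L'.weierstrassPRe (L'.minRealPeriod / 2)) ∧ (∀ x : ℝ, L.weierstrassPRe (L.minRealPeriod / 2) < x → HasDerivAt Φ (b * Real.sqrt (Φ x ^ 3 + α' * Φ x + β') / Real.sqrt (x ^ 3 + α * x + β)) x) ∧ ∀ x : ℝ, L.weierstrassPRe (L.minRealPeriod / 2) < x → ∃ z : ℝ, 0 < z ∧ z < L.minRealPeriod / 2 ∧ L.weierstrassP (z : ℂ) = (x : ℂ) ∧ L'.weierstrassP ((b : ℂ) * (z : ℂ)) = (Φ x : ℂ))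
    (hZ : ∀ (L L' : PeriodPair), L.IsReal → L'.IsReal → IsAlgebraic ℚ L.g₂ → IsAlgebraic ℚ L.g₃ → IsAlgebraic ℚ L'.g₂ → IsAlgebraic ℚ L'.g₃ → ∀ (ν : ℝ), ν ≠ 0 → (∀ l ∈ L.lattice, (ν : ℂ) * l ∈ L'.lattice) → ∀ (b : ℝ), L'.minRealPeriod = b * L.minRealPeriod → ∀ (e : ℝ) (Φ : ℝ → ℝ), (∀ x : ℝ, e < x → ∃ z : ℝ, 0 < z ∧ z < L.minRealPeriod / 2 ∧ L.weierstrassP (z : ℂ) = (x : ℂ) ∧ L'.weierstrassP ((b : ℂ) * (z : ℂ)) = (Φ x : ℂ)) → IsAlgebraic ℚ b ∧ ∃ Z : Set (Fin 2 → ℝ), Literature.ModelTheory.ExponentialFields.IsSemialgebraic ℚ Z ∧ (∀ x : ℝ, e < x → {y : ℝ | (![x, y] : Fin 2 → ℝ) ∈ Z}.Finite) ∧ ∀ x : ℝ, e < x → (![x, Φ x] : Fin 2 → ℝ) ∈ Z)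
    (hM : ∀ (α β α' β' : ℝ) (e e' : ℝ), (∀ x : ℝ, e < x → 0 < x ^ 3 + α * x + β) → (∀ x : ℝ, e' < x → 0 < x ^ 3 + α' * x + β') → ∀ (b c c' : ℝ), 0 < b → c = b * c' → ∀ (Φ : ℝ → ℝ), StrictMonoOn Φ (Set.Ioi e) → Φ '' Set.Ioi e = Set.Ioi e' → (∀ x : ℝ, e < x → HasDerivAt Φ (b * Real.sqrt (Φ x ^ 3 + α' * Φ x + β') / Real.sqrt (x ^ 3 + α * x + β)) x) → Literature.ModelTheory.ExponentialFields.IsSemialgebraic ℚ {p : Fin 2 → ℝ | e < p 0 ∧ p 1 = Φ (p 0)} → ∀ (r₁ r₁' : Literature.NumberTheory.Transcendental.KZ.IntegralRep 1), r₁.domain = {x | e < x 0} → Set.EqOn r₁.integrand (fun x => c / Real.sqrt (x 0 ^ 3 + α * x 0 + β)) r₁.domain → r₁'.domain = {x | e' < x 0} → Set.EqOn r₁'.integrand (fun x => c' / Real.sqrt (x 0 ^ 3 + α' * x 0 + β')) r₁'.domain → Literature.NumberTheory.Transcendental.KZ.of r₁ - Literature.NumberTheory.Transcendental.KZ.of r₁'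 ∈ Literature.NumberTheory.Transcendental.KZ.changeOfVariablesRel)
    (hI : ∀ (k : ℕ) (α β q : Fin k → ℝ), (∀ i, IsAlgebraic ℚ (α i) ∧ IsAlgebraic ℚ (β i) ∧ IsAlgebraic ℚ (q i)) → (∀ i, 4 * α i ^ 3 + 27 * β i ^ 2 ≠ 0) → (∀ i j, i ≠ j → ¬ ∃ (L L' : PeriodPair) (ν : ℝ), L.IsReal ∧ L'.IsReal ∧ L.g₂ = -4 * ((α i : ℝ) : ℂ) ∧ L.g₃ = -4 * ((β i : ℝ) : ℂ) ∧ L'.g₂ = -4 * ((α j : ℝ) : ℂ) ∧ L'.g₃ = -4 * ((β j : ℝ) : ℂ) ∧ ν ≠ 0 ∧ ∀ l ∈ L.lattice, (ν : ℂ) * l ∈ L'.lattice) → ∑ i, q i * (∫ x in {x : Fin 1 → ℝ | 0 < x 0 ^ 3 + α i * x 0 + β i}, 1 / Real.sqrt (x 0 ^ 3 + α i * x 0 + β i)) = 0 → ∀ i, q i = 0)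
    (hC : ∀ (Rel : ℝ → ℝ → ℝ → ℝ → Prop), (∀ (α β a : ℝ), IsAlgebraic ℚ α → IsAlgebraic ℚ β → IsAlgebraic ℚ a → 4 * α ^ 3 + 27 * β ^ 2 ≠ 0 → ∃ r : Literature.NumberTheory.Transcendental.KZ.IntegralRep 1, r.domain = {x | 0 < x 0 ^ 3 + α * x 0 + β} ∧ r.integrand = fun x => a / Real.sqrt (x 0 ^ 3 + α * x 0 + β)) → (∀ (α β α' β' : ℝ), IsAlgebraic ℚ α → IsAlgebraic ℚ β → IsAlgebraic ℚ α' → IsAlgebraic ℚ β' → 4 * α ^ 3 + 27 * β ^ 2 ≠ 0 → 4 * α' ^ 3 + 27 * β' ^ 2 ≠ 0 → Rel α β α' β' → ∀ (a a' : ℝ), IsAlgebraic ℚ a → IsAlgebraic ℚ a' → 0 < a → 0 < a' → ∀ (r r' : Literature.NumberTheory.Transcendental.KZ.IntegralRep 1), r.domain = {x | 0 < x 0 ^ 3 + α * x 0 + β} → Set.EqOn r.integrand (fun x => a / Real.sqrt (x 0 ^ 3 + α * x 0 + β)) r.domain → r'.domain = {x | 0 < x 0 ^ 3 + α' * x 0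 + β'} → Set.EqOn r'.integrand (fun x => a' / Real.sqrt (x 0 ^ 3 + α' * x 0 + β')) r'.domain → r.value = r'.value → Literature.NumberTheory.Transcendental.KZ.of r - Literature.NumberTheory.Transcendental.KZ.of r' ∈ Literature.NumberTheory.Transcendental.KZ.relations) → (∀ (α β α' β' : ℝ), IsAlgebraic ℚ α → IsAlgebraic ℚ β → IsAlgebraic ℚ α' → IsAlgebraic ℚ β' → 4 * α ^ 3 + 27 * β ^ 2 ≠ 0 → 4 * α' ^ 3 + 27 * β' ^ 2 ≠ 0 → Rel α β α' β' → ∃ q : ℝ, IsAlgebraic ℚ q ∧ 0 < q ∧ (∫ x in {x : Fin 1 → ℝ | 0 < x 0 ^ 3 + α * x 0 + β}, 1 / Real.sqrt (x 0 ^ 3 + α * x 0 + β)) = q * (∫ x in {x : Fin 1 → ℝ | 0 < x 0 ^ 3 + α' * x 0 + β'}, 1 / Real.sqrt (x 0 ^ 3 + α' * x 0 + β'))) → (∀ (k : ℕ) (α β q : Fin k → ℝ), (∀ i, IsAlgebraic ℚ (α i) ∧ IsAlgebraic ℚ (β i) ∧ IsAlgebraic ℚ (q i)) → (∀ i, 4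 * α i ^ 3 + 27 * β i ^ 2 ≠ 0) → (∀ i j, i ≠ j → ¬ Rel (α i) (β i) (α j) (β j)) → ∑ i, q i * (∫ x in {x : Fin 1 → ℝ | 0 < x 0 ^ 3 + α i * x 0 + β i}, 1 / Real.sqrt (x 0 ^ 3 + α i * x 0 + β i)) = 0 → ∀ i, q i = 0) → ∀ c ∈ AddSubgroup.closure {d : Literature.NumberTheory.Transcendental.KZ.FormalRep | ∃ (α β a : ℝ) (r : Literature.NumberTheory.Transcendental.KZ.IntegralRep 1), IsAlgebraic ℚ α ∧ IsAlgebraic ℚ β ∧ IsAlgebraic ℚ a ∧ 4 * α ^ 3 + 27 * β ^ 2 ≠ 0 ∧ r.domain = {x | 0 < x 0 ^ 3 + α * x 0 + β} ∧ Set.EqOn r.integrand (fun x => a / Real.sqrt (x 0 ^ 3 + α * x 0 + β)) r.domain ∧ d = Literature.NumberTheory.Transcendental.KZ.of r}, Literature.NumberTheory.Transcendental.KZ.eval c = 0 → c ∈ Literature.NumberTheory.Transcendental.KZ.relations) :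
    AlgebraicModuliRealPeriodCell := by
  have hS := stub_algSectorRepsExist
  refine hC RealRel hS ?_ ?_ ?_
  · -- (T_Rel) pair transfer along a real multiplier
    intro α β α' β' hα hβ hα' hβ' hΔ hΔ' hrel a a' ha ha' ha0 ha0' r r' hd hi hd' hi' hv
    exact (transfer_of_realRel hU hB hZ hM hα hβ hα' hβ' hΔ hΔ' hrel ha ha' ha0 ha0' r r' hd hi hd' hi').2 hv
  · -- (V_Rel) the period ratio along a real multiplier is positive algebraic
    intro α β α' β' hα hβ hα' hβ' hΔ hΔ' hrel
    obtain ⟨r, hd, hi⟩ := hS α β 1 hα hβ isAlgebraic_one hΔ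
    obtain ⟨r', hd', hi'⟩ := hS α' β' 1 hα' hβ' isAlgebraic_one hΔ'
    have hie : EqOn r.integrand (fun x => 1 / Real.sqrt (x 0 ^ 3 + α * x 0 + β)) r.domain := by
      rw [hi]; exact fun x _ => rfl
    have hie' : EqOn r'.integrand (fun x => 1 / Real.sqrt (x 0 ^ 3 + α' * x 0 + β')) r'.domain := by
      rw [hi']; exact fun x _ => rfl
    obtain ⟨⟨q, hq, hq0, hratio⟩, -⟩ := transfer_of_realRel hU hB hZ hM hα hβ hα' hβ' hΔ hΔ' hrel
      isAlgebraic_one isAlgebraic_one one_pos one_pos r r' hd hie hd' hie'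
    refine ⟨q, hq, hq0, ?_⟩
    rw [value_eq r hd hie, value_eq r' hd' hie'] at hratio
    simpa using hratio
  · -- (I_Rel) independence of really-unrelated curves
    intro k α β q halg hns hunrel hsum
    exact hI k α β q halg hns (fun i j hij => hunrel i j hij) hsum

end Summit.KontsevichZagierPeriods.KontsevichZagierPeriods.Cruxes.AlgebraicModuliRealPeriodCell.RealMultiplierBranch

end
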